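import Summits.CriticalPhenomena.SAWScalingLimit.Theorems.SAWRenewalTightnessConfinementPositivityBridgeTubeCosine
import Summits.CriticalPhenomena.SAWScalingLimit.Theorems.SAWRenewalTightnessTubeLowerBoundFlipWord
import Summits.CriticalPhenomena.SAWScalingLimit.Theorems.SAWRenewalTightnessKestenIdentity
import Summits.CriticalPhenomena.SAWScalingLimit.Theorems.SAWRenewalTightnessStripMassConservation
import HarnessLib

/-!
# Crux `ConfinementPositivity` (stmt-CriticalPhenomena-17587), line `Sketch` (sign-universality):
# Kesten pieces as a flip-symmetric piece type — the inputs of the unpinned slab tube (stub B′u)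

Lemmas instantiating the generic cosine tube comparison `Theorems.cosineTube_claim`
(`…ConfinementPositivityBridgeTubeCosine.lean`) at the piece type `{w : List Step // IsIrrBridge w}` of
Kesten's irreducible bridges with the critical weight `ν w = x_c^{|w|}`:

* `UnpinnedSlabTube.wEnd_map_flip_snd`, `ext_map_flip` — the word flip `y ↦ -y` (`FlipWord.*`) negates the
  height increment `wEnd · 1` and preserves the vertical extent (span, length, irreducibility: `FlipWord`);
* `UnpinnedSlabTube.natAbs_wEnd_le_ext`, `natAbs_traj_le_ext` — `|H| ≤ ext`, `|yᵢ| ≤ ext`;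
* `UnpinnedSlabTube.tsum_weight_eq_one` — Kesten's identity `Σ_irr x_c^{|w|} = 1` in `ℝ≥0∞`
  (from `Theorems.KestenIdentity_proof`), and `tsum_prod_weight` — the product structure
  `Σ'_{f : Fin k → P} ∏ ν (f i) = (Σ' ν)^k`;
* `UnpinnedSlabTube.card_le_sum_xEnd` — every piece has span `≥ 1`, so a `k`-tuple has total span `≥ k`;
* `unpinnedSlabTube_abs_traj_flatten_le` — if the piece-boundary heights of a tuple stay in `[-r, r]` and every
  piece has extent `≤ E₀`, every height of the concatenation lies in `[-(r + E₀), r + E₀]`.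

All elementary; no new definitions (the extent is written out as `(range (|w|+1)).sup (|y_i|)`).
-/

noncomputable section

open scoped BigOperators ENNReal
open Classical
open Literature.Probability.LatticeModels
open Literature.Probability.RandomPlanarGeometry Literature.Probability.RandomPlanarGeometry.SAW
open Summit.CriticalPhenomena.SAWScalingLimit.Theorems.TubeLowerBound.SubcriticalRenewalFloor

namespace Summit.CriticalPhenomena.SAWScalingLimit.Theorems

namespace UnpinnedSlabTube

/-! ### The flip on words: height increment and extent -/

/-- The flip negates the height increment. -/
theorem wEnd_map_flip_snd (w : List Step) :
    wEnd (w.map fun d : Step => if d = 1 then 3 else if d = 3 then 1 else d) 1 = -wEnd w 1 := by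
  rw [← traj_length, (FlipWord.traj_map_flip w _).2, List.length_map, traj_length]

/-- The flip preserves the vertical extent. -/
theorem ext_map_flip (w : List Step) :
    ((Finset.range ((w.map fun d : Step => if d = 1 then 3 else if d = 3 then 1 else d).length + 1)).sup
        fun i => (traj (w.map fun d : Step => if d = 1 then 3 else if d = 3 then 1 else d) i 1).natAbs) =
      (Finset.range (w.length + 1)).sup fun i => (traj w i 1).natAbs := by
  rw [List.length_map]
  refine Finset.sup_congr rfl fun i _ => ?_
  rw [(FlipWord.traj_map_flip w i).2, Int.natAbs_neg]

/-! ### Heights versus the extent -/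

/-- Every height of a word is at most its extent. -/
theorem natAbs_traj_le_ext (w : List Step) (i : ℕ) :
    (traj w i 1).natAbs ≤ (Finset.range (w.length + 1)).sup fun j => (traj w j 1).natAbs := by
  rcases le_or_gt i w.length with hi | hi
  · exact Finset.le_sup (f := fun j => (traj w j 1).natAbs) (Finset.mem_range.2 (Nat.lt_succ_of_le hi))
  · rw [traj_of_le w hi.le, ← traj_length]
    exact Finset.le_sup (f := fun j => (traj w j 1).natAbs) (Finset.mem_range.2 (Nat.lt_succ_self _))

/-- The height increment of a word is at most its extent (as integers). -/
theorem abs_wEnd_le_ext (w : List Step) :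
    |wEnd w 1| ≤ (((Finset.range (w.length + 1)).sup fun j => (traj w j 1).natAbs : ℕ) : ℤ) := by
  rw [← traj_length, ← Int.natCast_natAbs]
  exact_mod_cast natAbs_traj_le_ext w w.length

/-! ### Kesten's identity in `ℝ≥0∞` and the product structure of tuple sums -/

/-- Kesten's identity `Σ_{irr} x_c^{|w|} = 1` as an `ℝ≥0∞`-valued sum over the piece type. -/
theorem tsum_weight_eq_one :
    ∑' w : {w : List Step // IsIrrBridge w}, ENNReal.ofReal (criticalFugacity ^ w.1.length) = 1 := by
  have h := KestenIdentity_proof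
  unfold Summit.CriticalPhenomena.SAWScalingLimit.Theses.SAWRenewalTightness.KestenIdentity at h
  rw [← ENNReal.ofReal_tsum_of_nonneg (fun w => pow_nonneg KestenIdentity.criticalFugacity_nonneg _)
    h.summable, h.tsum_eq, ENNReal.ofReal_one]

/-- Product structure: `Σ'_{f : Fin k → P} ∏ ν (f i) = (Σ' ν)^k` in `ℝ≥0∞`. -/
theorem tsum_prod_weight {P : Type*} (ν : P → ℝ≥0∞) :
    ∀ k : ℕ, ∑' f : Fin k → P, ∏ i, ν (f i) = (∑' p, ν p) ^ k := by
  intro k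
  induction k with
  | zero =>
    rw [BridgeTubeCosine.tsum_fin_zero, pow_zero]
    simp
  | succ k ih =>
    rw [BridgeTubeCosine.tsum_succ_eq, pow_succ, mul_comm, ← ENNReal.tsum_mul_right]
    refine tsum_congr fun s => ?_
    rw [← ih, ← ENNReal.tsum_mul_left]
    refine tsum_congr fun g => ?_
    rw [BridgeTubeCosine.prod_cons ν s g]

/-- The indicator-restricted tuple mass is at most `1`: `Σ'_{f} [Q f] ∏ x_c^{|f i|} ≤ 1`. -/
theorem tsum_ite_prod_weight_le_one (k : ℕ) (Q : (Fin k → {w : List Step // IsIrrBridge w}) → Prop)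
    [DecidablePred Q] :
    (∑' f : Fin k → {w : List Step // IsIrrBridge w},
        if Q f then ∏ i, ENNReal.ofReal (criticalFugacity ^ (f i).1.length) else 0) ≤ 1 := by
  calc (∑' f : Fin k → {w : List Step // IsIrrBridge w},
        if Q f then ∏ i, ENNReal.ofReal (criticalFugacity ^ (f i).1.length) else 0)
      ≤ ∑' f : Fin k → {w : List Step // IsIrrBridge w},
          ∏ i, ENNReal.ofReal (criticalFugacity ^ (f i).1.length) :=
        ENNReal.tsum_le_tsum fun f => by split_ifs <;> simp
    _ = 1 := by
        rw [tsum_prod_weight (fun w : {w : List Step // IsIrrBridge w} =>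
          ENNReal.ofReal (criticalFugacity ^ w.1.length)) k, tsum_weight_eq_one, one_pow]

/-! ### Spans -/

/-- An irreducible bridge has span `≥ 1`. -/
theorem one_le_xEnd (w : {w : List Step // IsIrrBridge w}) : 1 ≤ xEnd w.1 :=
  StripMass.one_le_xEnd_of_ne_nil w.2.bridge w.2.ne_nil

/-- A `k`-tuple of irreducible bridges has total span `≥ k`. -/
theorem card_le_sum_xEnd {k : ℕ} (f : Fin k → {w : List Step // IsIrrBridge w}) :
    (k : ℤ) ≤ ∑ i, xEnd (f i).1 := by
  calc (k : ℤ) = ∑ _i : Fin k, (1 : ℤ) := by simp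
    _ ≤ ∑ i, xEnd (f i).1 := Finset.sum_le_sum fun i _ => one_le_xEnd (f i)

end UnpinnedSlabTube

/-! ### Heights of a concatenation -/

/-- **Heights of a concatenation.** If the piece-boundary heights `y + Σ_{i<j} H(f i)` (`j ≤ k`) lie in
`[-r, r]` and every piece has extent `≤ E₀`, then every height `y + y_t` of the concatenation
`(List.ofFn f).flatten` lies in `[-(r + E₀), r + E₀]`. -/
theorem unpinnedSlabTube_abs_traj_flatten_le : ∀ (r E₀ : ℤ), 0 ≤ E₀ →
    ∀ (k : ℕ) (f : Fin k → List Step) (y : ℤ),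
      (∀ j ≤ k, |y + ∑ i : Fin k, (if (i : ℕ) < j then wEnd (f i) 1 else 0)| ≤ r) →
      (∀ i, (((Finset.range ((f i).length + 1)).sup fun t => (traj (f i) t 1).natAbs : ℕ) : ℤ) ≤ E₀) →
      ∀ t, |y + traj (List.ofFn f).flatten t 1| ≤ r + E₀ := by
  intro r E₀ hE₀ k
  induction k with
  | zero =>
    intro f y hy _ t
    have h0 := hy 0 le_rfl
    simp only [Finset.univ_eq_empty, Finset.sum_empty, add_zero] at h0
    simp only [List.ofFn_zero, List.flatten_nil]
    rw [show traj ([] : List Step) t = 0 from by simp [traj, wEnd]]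
    simp only [Pi.zero_apply, add_zero]
    exact h0.trans (le_add_of_nonneg_right hE₀)
  | succ k ih =>
    intro f y hy hext t
    -- split off the first piece
    have hf : f = Fin.cons (f 0) (Fin.tail f) := (Fin.cons_self_tail f).symm
    set s := f 0 with hs_def
    set g := Fin.tail f with hg_def
    rw [hf] at hy hext
    rw [hf, List.ofFn_succ]
    simp only [Fin.cons_zero, Fin.cons_succ, List.flatten_cons]
    rw [BridgeTubeCosine.tubePred_cons_iff (fun w => wEnd w 1) r s g y] at hy
    rw [BridgeTubeCosine.forall_cons_iff
      (fun w => (((Finset.range (w.length + 1)).sup fun t => (traj w t 1).natAbs : ℕ) : ℤ) ≤ E₀) s g] at hext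
    obtain ⟨hy0, hyg⟩ := hy
    obtain ⟨hs, hg⟩ := hext
    rcases le_or_gt t s.length with ht | ht
    · rw [traj_append_left _ _ ht]
      have h1 : ((traj s t 1).natAbs : ℤ) ≤ E₀ := le_trans (by exact_mod_cast UnpinnedSlabTube.natAbs_traj_le_ext s t) hs
      have h2 : |traj s t 1| ≤ E₀ := by rwa [← Int.natCast_natAbs]
      calc |y + traj s t 1| ≤ |y| + |traj s t 1| := abs_add_le _ _
        _ ≤ r + E₀ := add_le_add hy0 h2
    · obtain ⟨u, rfl⟩ : ∃ u, t = s.length + u := ⟨t - s.length, by omega⟩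
      rw [traj_append_right, Pi.add_apply, ← add_assoc]
      exact ih g (y + wEnd s 1) hyg hg u


end Summit.CriticalPhenomena.SAWScalingLimit.Theorems
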